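import Mathlib
import HarnessLib
import Summits.HubbardSuperconductivity.HubbardSuperconductivity.Theorems.KLProgrammeKLRegimeWickScaleFlow
import Summits.HubbardSuperconductivity.HubbardSuperconductivity.Theorems.KLProgrammeKLRegimeWickScaleFlowConservation
import Summits.HubbardSuperconductivity.HubbardSuperconductivity.Theorems.KLProgrammeKLRegimeWickLegDressing

/-!
# Route `KLProgramme` — crux K3, ENGINE child gen 5 (stmt-HubbardSuperconductivity-19918 `KLRegimeEngineV14`), stub `stub_engine_step_values`,
# conjunct (E2-v9/v10) at `1 ≤ n`: the source of the Wick scale flow in CROSS-CONTRACTION form — `klws_hasDerivAt_kernel_wickActionR_cross`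

Cell gate-hubbard-kl, seat hubbard-kl-k3c1-p1 (g6), technique «composed-map remainder propagation».  The glue between the scale flow of the
Wick-smeared action (`…WickScaleFlow`, p504230: `∂_Λ kernel_m(𝒲_Λ) = −½·kernel_m(e^{Δ_{D_Λ}}(δ𝒱_Λ/δψ, Ċ_Λ δ𝒱_Λ/δψ))`) and p1's doubled-algebra
colouring machinery (`…WickStarProduct` p483614, `…WickCrossContractionIterate`, `…WickBubbleColourings*`, `…WickLegDressing`), which reads terms of
the shape `dblFold(Δ_×(C₁)·Δ_×(C₂)^k (𝒲⁰·𝒲¹))`.  The discrete step is `dblFold((e^{Δ_×(g)} − 1) e^{Δ_×(D)}(𝒲⁰𝒲¹))` (`klw_wickAction_succ_cross`,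
p484175); here is its continuous counterpart, with `(e^{Δ_×(g)} − 1) ↦ Δ_×(Ċ_Λ)` (exactly ONE derivative line):

* §1 generic (commutative `ℚ`-algebra, finite labels): `klws_contr_of_antisymm` (`contr C = −C` for `Cᵀ = −C`),
  **`klws_dblFold_crossLaplacian_copy_mul_copy`** — for antisymmetric `C` and even `a`: `dblFold(Δ_×(C)(a⁰·b¹)) = (δa/δψ, C δb/δψ)_Γ`;
  **`klws_gaussConv_derivPairing_eq_dblFold_cross`** — for antisymmetric `C` and even `v`, `W = e^{Δ_D}v`:
  `e^{Δ_D}(δv/δψ, C δv/δψ)_Γ = dblFold(Δ_×(C)(e^{Δ_×(D)}(W⁰·W¹)))` (the diagonal blocks of the folded covariance turn the two copies of `v`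
  into copies of `W`; the cross block stays; `Δ_×(C)` commutes with every smearing).
* §2 model (seed `0`, frame `K`, real cutoff, `Λ ≠ 0`, `Z^K_Λ ≠ 0`): antisymmetry of the derivative line `klws_derivHardCov_transpose`, and
  **`klws_hasDerivAt_kernel_wickActionR_cross`**:
  `∂_Λ kernel_m(𝒲_Λ) = −½·kernel_m(dblFold(Δ_×(Ċ_Λ)(e^{Δ_×(D_Λ)}(𝒲_Λ⁰·𝒲_Λ¹))))`, `m ≥ 1`
  (+ the `vertexFn` and pair-kernel forms) — so the line-number expansion `e^{Δ_×(D_Λ)} = Σ_k Δ_×(D_Λ)^k/k!` files the source into p1's classes: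
  `k = 0` one `Ċ_Λ` line (leg dressing `𝒲₂⊗𝒲₄`, `kernel_dblFold_oneLine_self`), `k = 1` the two-line bubbles `Δ_×(Ċ_Λ)Δ_×(D_Λ)`
  (`kernel_dblFold_bubble_self`, three channels; pp part = the Riccati term, `bubbleSum_pp_pairKernel_wickActionR`), `k ≥ 2` overlapping loops.

Exact algebra + p504230; nothing about superconductivity is asserted.  0 kit.
-/

noncomputable section

namespace Summit.HubbardSuperconductivity.HubbardSuperconductivity.Theorems.KLRegimeWick

set_option linter.dupNamespace false -- summit = problem name (single-conjunct summit), D-0017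

open Literature.MathematicalPhysics.QuantumLattice GrassmannAlgebra Finset Matrix
open scoped Topology

/-! ## §1 Generic: the derivative pairing as a folded cross contraction -/

section Generic

variable (R : Type*) [CommRing R] [Algebra ℚ R] {Γ : Type*} [Fintype Γ] [DecidableEq Γ]

omit [Fintype Γ] [DecidableEq Γ] in
/-- For an antisymmetric covariance the two-point function is `contr C = −C` entrywise. -/
theorem klws_contr_of_antisymm (C : Matrix Γ Γ R) (hC : C.transpose = -C) (X Y : Γ) : contr R C X Y = -C X Y := by
  have hYX : C Y X = -C X Y := by
    have h := congrFun (congrFun hC X) Y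
    simpa only [Matrix.transpose_apply, Matrix.neg_apply] using h
  rw [contr_apply, hYX, show -C X Y - C X Y = (2 : ℚ) • (-C X Y) by rw [two_smul]; ring, smul_one_mul, smul_smul]
  norm_num

/-- **`dblFold(Δ_×(C)(a⁰·b¹)) = (δa/δψ, C δb/δψ)_Γ`** for antisymmetric `C` and even `a`: the single cross contraction, folded, is Salmhofer's
derivative pairing. -/
theorem klws_dblFold_crossLaplacian_copy_mul_copy (C : Matrix Γ Γ R) (hC : C.transpose = -C) {a : GrassmannAlgebra R Γ}
    (ha : a ∈ evenOdd R 0) (b : GrassmannAlgebra R Γ) :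
    dblFold R (grassmannLaplacian R (crossCov R C) (dblCopy R 0 a * dblCopy R 1 b)) = grassmannDerivPairing R C a b := by
  rw [grassmannLaplacian_crossCov_copy_mul_copy, map_sum, grassmannDerivPairing_apply]
  refine Finset.sum_congr rfl fun X _ => ?_
  rw [map_sum]
  refine Finset.sum_congr rfl fun Y _ => ?_
  rw [map_smul, map_mul, dblFold_dblCopy, dblFold_dblCopy,
    CliffordAlgebra.involute_eq_of_mem_odd (grassmannDeriv_mem_evenOdd_one_of_zero R X ha), klws_contr_of_antisymm R C hC,
    neg_mul, smul_neg, neg_smul, neg_neg]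

/-- **`e^{Δ_D}(δv/δψ, C δv/δψ)_Γ = dblFold(Δ_×(C)(e^{Δ_×(D)}(W⁰·W¹)))`**, `W = e^{Δ_D}v`, for antisymmetric `C` and even `v`: the smeared bilinear
term of the RGE is the `C`-cross-contraction of the two `D`-cross-smeared copies of the Wick carrier. -/
theorem klws_gaussConv_derivPairing_eq_dblFold_cross (C D : Matrix Γ Γ R) (hC : C.transpose = -C) {v : GrassmannAlgebra R Γ}
    (hv : v ∈ evenOdd R 0) :
    gaussConv R D (grassmannDerivPairing R C v v) =
      dblFold R (grassmannLaplacian R (crossCov R C)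
        (gaussConv R (crossCov R D) (dblCopy R 0 (gaussConv R D v) * dblCopy R 1 (gaussConv R D v)))) := by
  have h01 : (0 : Fin 2) ≠ 1 := by decide
  rw [← klws_dblFold_crossLaplacian_copy_mul_copy R C hC hv v, gaussConv_dblFold]
  -- commute the smearing past `Δ_×(C)`
  have hcomm := (commute_gaussConv_grassmannLaplacian R (dblCov R D 0 0 + dblCov R D 1 1 + crossCov R D) (crossCov R C)).eq
  have happ := congrArg (fun T : Module.End R (GrassmannAlgebra R (Γ × Fin 2)) => T (dblCopy R 0 v * dblCopy R 1 v)) hcomm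
  simp only [Module.End.mul_apply] at happ
  rw [happ]
  congr 2
  -- the diagonal blocks turn the copies of `v` into copies of `W`
  rw [add_comm (dblCov R D 0 0 + dblCov R D 1 1), gaussConv_add_apply, gaussConv_add_apply,
    gaussConv_mul_eq_mul_of_mem R (dblCov R D 1 1) (fun p q h => dblCov_eq_zero_of_mem R h01 D p q h)
      (dblCopy_mem_fieldSubalgebra R 0 v) (dblCopy_mem_evenOdd_zero R 0 hv),
    gaussConv_dblCov_dblCopy,
    gaussConv_mul_eq_mul_of_mem_right R (dblCov R D 0 0) (fun p q h => dblCov_eq_zero_of_mem R h01.symm D p q h) _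
      (dblCopy_mem_fieldSubalgebra R 1 _),
    gaussConv_dblCov_dblCopy]

end Generic

/-! ## §2 The model: the source of the Wick scale flow in cross-contraction form -/

section Model

open Literature.Probability.LatticeModels
open Summit.HubbardSuperconductivity.HubbardSuperconductivity.Theorems.KLProgrammeLegKernels
open Summit.HubbardSuperconductivity.HubbardSuperconductivity.Theorems.KLRegimeSplit

variable (L M : ℕ) [NeZero L] (β U μ : ℝ) (K : TrigPolyC4v)

omit [NeZero L] in
/-- **The derivative line is antisymmetric** (the hard covariance is, at every scale). -/
theorem klws_derivHardCov_transpose (Λ : ℝ) :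
    (Matrix.of fun X Y : HubbardFieldIdx L M => deriv (fun Λ' : ℝ => hubbardCovAboveCT L M β μ 0 K Λ' X Y) Λ).transpose =
      -(Matrix.of fun X Y : HubbardFieldIdx L M => deriv (fun Λ' : ℝ => hubbardCovAboveCT L M β μ 0 K Λ' X Y) Λ) := by
  ext X Y
  simp only [Matrix.transpose_apply, Matrix.neg_apply, Matrix.of_apply]
  have h : (fun Λ' : ℝ => hubbardCovAboveCT L M β μ 0 K Λ' Y X) = fun Λ' : ℝ => -hubbardCovAboveCT L M β μ 0 K Λ' X Y := by
    funext Λ'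
    have ht := congrFun (congrFun (hubbardCovAboveCT_transpose L M β μ 0 K Λ') X) Y
    simpa only [Matrix.transpose_apply, Matrix.neg_apply] using ht
  rw [h]
  show deriv (-(fun Λ' : ℝ => hubbardCovAboveCT L M β μ 0 K Λ' X Y)) Λ = _
  rw [deriv.neg]

/-- **The source of the Wick scale flow in cross-contraction form** (kernels of positive degree):
`∂_Λ kernel_m(𝒲_Λ) = −½·kernel_m(dblFold(Δ_×(Ċ_Λ)(e^{Δ_×(D_Λ)}(𝒲_Λ⁰·𝒲_Λ¹))))`, `Ċ_Λ = ∂_Λ C^K_{>Λ}` (the tree's derivative, `Λ ≠ 0`),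
`D_Λ = C^K_{≤Λ}`, `Z^K_Λ ≠ 0` — the continuous counterpart of `klw_wickAction_succ_cross`. -/
theorem klws_hasDerivAt_kernel_wickActionR_cross {Λ : ℝ} (hΛ : Λ ≠ 0) (hZ : hubbardEffPartitionFnCT L M β U μ 0 K Λ ≠ 0) {m : ℕ}
    (hm : 0 < m) (X : Fin m → HubbardFieldIdx L M) :
    HasDerivAt (fun Λ' : ℝ => kernel ℂ (gaussConv ℂ (hubbardCovBelowCT L M β μ 0 K Λ')
        (hubbardEffectiveActionCT L M β U μ 0 K Λ')) m X)
      (-((2 : ℂ)⁻¹ * kernel ℂ (dblFold ℂ (grassmannLaplacian ℂ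
        (crossCov ℂ (Matrix.of fun X Y : HubbardFieldIdx L M => deriv (fun Λ' : ℝ => hubbardCovAboveCT L M β μ 0 K Λ' X Y) Λ))
        (gaussConv ℂ (crossCov ℂ (hubbardCovBelowCT L M β μ 0 K Λ))
          (dblCopy ℂ 0 (gaussConv ℂ (hubbardCovBelowCT L M β μ 0 K Λ) (hubbardEffectiveActionCT L M β U μ 0 K Λ)) *
            dblCopy ℂ 1 (gaussConv ℂ (hubbardCovBelowCT L M β μ 0 K Λ) (hubbardEffectiveActionCT L M β U μ 0 K Λ)))))) m X)) Λ := by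
  have h := klws_hasDerivAt_kernel_wickActionR L M β U μ K (klws_hasDerivAt_hardCov_scale L M β μ K hΛ) hZ hm X
  rwa [klws_gaussConv_derivPairing_eq_dblFold_cross ℂ _ _ (klws_derivHardCov_transpose L M β μ K Λ)
    (klws_effectiveActionR_mem_evenOdd_zero β U μ K Λ)] at h

/-- **Vertex-function form**: `∂_Λ 𝒱_m(𝒲_Λ)(X) = −½·𝒱_m(dblFold(Δ_×(Ċ_Λ)(e^{Δ_×(D_Λ)}(𝒲_Λ⁰·𝒲_Λ¹))))(X)`, `m ≥ 1`. -/
theorem klws_hasDerivAt_vertexFn_wickActionR_cross {Λ : ℝ} (hΛ : Λ ≠ 0) (hZ : hubbardEffPartitionFnCT L M β U μ 0 K Λ ≠ 0) {m : ℕ}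
    (hm : 0 < m) (X : Fin m → HubbardFieldIdx L M) :
    HasDerivAt (fun Λ' : ℝ => vertexFn L M β (gaussConv ℂ (hubbardCovBelowCT L M β μ 0 K Λ')
        (hubbardEffectiveActionCT L M β U μ 0 K Λ')) m X)
      (-((2 : ℂ)⁻¹ * vertexFn L M β (dblFold ℂ (grassmannLaplacian ℂ
        (crossCov ℂ (Matrix.of fun X Y : HubbardFieldIdx L M => deriv (fun Λ' : ℝ => hubbardCovAboveCT L M β μ 0 K Λ' X Y) Λ))
        (gaussConv ℂ (crossCov ℂ (hubbardCovBelowCT L M β μ 0 K Λ))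
          (dblCopy ℂ 0 (gaussConv ℂ (hubbardCovBelowCT L M β μ 0 K Λ) (hubbardEffectiveActionCT L M β U μ 0 K Λ)) *
            dblCopy ℂ 1 (gaussConv ℂ (hubbardCovBelowCT L M β μ 0 K Λ) (hubbardEffectiveActionCT L M β U μ 0 K Λ)))))) m X)) Λ := by
  have h := (klws_hasDerivAt_kernel_wickActionR_cross L M β U μ K hΛ hZ hm X).const_mul
    ((((m.factorial : ℝ) * (β * (L : ℝ) ^ 2) ^ (m - 1) : ℝ) : ℂ))
  simp only [vertexFn_def]
  refine h.congr_deriv ?_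
  ring

end Model

end Summit.HubbardSuperconductivity.HubbardSuperconductivity.Theorems.KLRegimeWick

end
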